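import Summits.Ventures.HSemireg.WedgeHankelSubstitutionCatalecticant
import Summits.Ventures.HSemireg.WedgeHankelSubstitutionTorelli

/-!
# Venture HSemireg — THE GENERAL LINEAR SUBSTITUTION (2c): THE MOMENT MATRICES MULTIPLY AND `det S_c(g) = (det g)^{c(c+1)/2}`
# (`S_c(g·g′) = S_c(g′)·S_c(g)`; lower substitutions are upper-triangular with diagonal `α^{c−l}δ^l`, the shear is the Pascal matrix; `S_c(adj g)·S_c(g) = (det g)^c·1`)

HONEST FRAMING. Part of the Lean index of the computation cell `pub-hsemireg` (seat p10 gen 19, Sunday typer «UNIFORM-IN-n»).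
LINEAR ALGEBRA of the moment matrices of th-7's sequence vocabulary ONLY: no variety, no cohomology theory, no sheaf, no Ext group, no semiregularity map;
nothing here says that HC / HC_CM / HC_AV holds; no Literature fact is declared or used.  Custodian versions as in `WedgeHankelSiegelIdeal` (1/3) and `WedgeHankelFrameChange`;
the dictionary (`S_c(g) = Sym^c` of the substitution on binary forms of degree `c`, whose determinant is the classical `(det g)^{c(c+1)/2}`) is QUOTED, never asserted.

WHAT IS IN THE TREE.  H7 `WedgeHankelSubstitutionCatalecticant` (908): the matrix `sbMat α β γ δ c d` of the degree-`c` moment transform (`(a, l) ↦ sbSeq c δ_l a`),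
`sbSeq_eq_sbMat_sum`, `H_k(sbSeq g n q) = S_k · H_k(q) · S_{n−k}ᵀ`; H1b `WedgeHankelSubstitutionSiegel` (909): the window action `sbSeq_comp_apply` (`sbSeq (g·g′) = sbSeq g′ ∘ sbSeq g` on
`[0, n]`), `sbSeq_one_apply`; H2 `WedgeHankelSubstitutionNodes` (915): lower substitutions keep supports `[0, P]` and multiply the top coefficient by `α^{m−P}δ^P`
(`sbSeq_lower_apply_eq_zero` / `_self`); H11 `WedgeHankelSubstitutionTorelli` (935): `sbSeq_scalar`; H12 (936): for a SINGULAR `g` the matrix `S_c(g)` is an outer product.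
H7's header named «`det S_c(g) = (det g)^{c(c+1)/2}`» as NOT typed.  THIS FILE types it (namespace `Summit.Ventures.HSemireg.Wedge.HankelFrameChange` continued):
* §159 **`sbMat_comp`: `S_c(g·g′) = S_c(g′) * S_c(g)`** as `(c+1) × (c+1)` matrices (the window action, column by column), `sbMat_one` (`S_c(1) = 1`), **`sbMat_scalar`** (`S_c(α·1) = α^c·1`),
  **`sbMat_adj_mul`: `S_c(adj g) * S_c(g) = (det g)^c · 1`** and `sbMat_mul_adj` — for `det g ≠ 0` the inverse matrix is `(det g)^{−c} S_c(adj g)`.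
* §160 LOWER substitutions (`β = 0`): `S_c(α 0 γ δ)` is UPPER triangular (`sbMat_lower_apply_of_lt`) with diagonal `α^{c−l} δ^l` (`sbMat_lower_apply_self`), hence
  **`det_sbMat_lower`: `det S_c(α 0 γ δ) = (αδ)^{c(c+1)/2}`** (`Σ_{l ≤ c} l = Σ_{l ≤ c} (c − l) = c(c+1)/2`).
* §161 the SHEAR: **`sbMat_shear_apply`: `S_c(1 λ 0 1)_{a,l} = C(a,l) λ^{a−l}`** (the lower-triangular Pascal matrix; E5's `expMul_eq_sum` on spikes), `det_sbMat_shear` (`= 1`).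
* §162 **THE DETERMINANT `det_sbMat`: `det S_c(α β γ δ) = (αδ − βγ)^{c(c+1)/2}` for EVERY `α β γ δ` over every field** — `α ≠ 0`: `g = L·U` with `L = (α, 0, γ, (αδ−βγ)/α)`,
  `U = (1, β/α, 0, 1)` (§159 + §160 + §161); `α = 0 ≠ β`: `g = (β, β, γ+δ, δ)·(1, 0, −1, 1)`; `α = β = 0`: §160 directly.  Corollaries: `det_sbMat_eq_zero_iff` / **`isUnit_sbMat_iff`**
  (`c ≥ 1`: `S_c(g)` is invertible iff `αδ − βγ ≠ 0`), `det_sbMat_zero_degree` (`S_0 = 1`).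
NOT typed here: `S_c(g)` as `Sym^c(g)` on a space of binary forms (none is constructed; dictionary only); the characteristic polynomial / eigenvalues of `S_c(g)`; anything class- or
Ext-side.  New names only.
-/

open Module
open scoped Matrix

namespace Summit.Ventures.HSemireg.Wedge.HankelFrameChange

open Summit.Ventures.HSemireg.Wedge Summit.Ventures.HSemireg.Wedge.Hankel

variable (K : Type*) [Field K]

/-! ## §159. The moment matrices multiply -/

/-- **`S_c(g·g′) = S_c(g′) * S_c(g)`**: the moment matrix of the product substitution `[[α,β],[γ,δ]]·[[α′,β′],[γ′,δ′]]` is the product of the moment matrices, the SECOND factor on the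
LEFT (H1b's window action `sbSeq (g·g′) = sbSeq g′ ∘ sbSeq g`, read column by column). -/
theorem sbMat_comp (α β γ δ α' β' γ' δ' : K) (c : ℕ) :
    sbMat K (α * α' + β * γ') (α * β' + β * δ') (γ * α' + δ * γ') (γ * β' + δ * δ') c (c + 1) = sbMat K α' β' γ' δ' c (c + 1) * sbMat K α β γ δ c (c + 1) := by
  ext a l
  rw [sbMat_apply, sbSeq_comp_apply K α β γ δ α' β' γ' δ' _ (n := c) (show (a : ℕ) ≤ c by have := a.2; omega), sbSeq_eq_sbMat_sum, Matrix.mul_apply]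
  exact Finset.sum_congr rfl fun l' _ => by rw [sbMat_apply K α β γ δ]

/-- **`S_c(1) = 1`.** -/
theorem sbMat_one (c : ℕ) : sbMat K 1 0 0 1 c (c + 1) = 1 := by
  ext a l
  rw [sbMat_apply, sbSeq_one_apply K _ (n := c) (show (a : ℕ) ≤ c by have := a.2; omega), Matrix.one_apply]
  by_cases h : a = l
  · rw [if_pos (congrArg Fin.val h), if_pos h]
  · rw [if_neg (fun e => h (Fin.ext e)), if_neg h]

/-- **`S_c(α·1) = α^c · 1`** (H11 `sbSeq_scalar`). -/
theorem sbMat_scalar (α : K) (c : ℕ) : sbMat K α 0 0 α c (c + 1) = α ^ c • (1 : Matrix (Fin (c + 1)) (Fin (c + 1)) K) := by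
  ext a l
  rw [sbMat_apply, sbSeq_scalar K α c _ (show (a : ℕ) ≤ c by have := a.2; omega), Matrix.smul_apply, Matrix.one_apply, smul_eq_mul]
  by_cases h : a = l
  · rw [if_pos (congrArg Fin.val h), if_pos h]
  · rw [if_neg (fun e => h (Fin.ext e)), if_neg h]

/-- **`S_c(adj g) * S_c(g) = (det g)^c · 1`** (`g · adj g = det g · 1` and §159). -/
theorem sbMat_adj_mul (α β γ δ : K) (c : ℕ) :
    sbMat K δ (-β) (-γ) α c (c + 1) * sbMat K α β γ δ c (c + 1) = (α * δ - β * γ) ^ c • (1 : Matrix (Fin (c + 1)) (Fin (c + 1)) K) := by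
  rw [← sbMat_comp, ← sbMat_scalar]
  congr 1 <;> ring

/-- **`S_c(g) * S_c(adj g) = (det g)^c · 1`** (`adj g · g = det g · 1`). -/
theorem sbMat_mul_adj (α β γ δ : K) (c : ℕ) :
    sbMat K α β γ δ c (c + 1) * sbMat K δ (-β) (-γ) α c (c + 1) = (α * δ - β * γ) ^ c • (1 : Matrix (Fin (c + 1)) (Fin (c + 1)) K) := by
  rw [← sbMat_comp, ← sbMat_scalar]
  congr 1 <;> ring

/-! ## §160. Lower substitutions: upper-triangular moment matrices -/

/-- a LOWER substitution (`β = 0`) has an UPPER-triangular moment matrix: `S_c(α 0 γ δ)_{a,l} = 0` for `l < a` (H2: supports `[0, l]` are kept). -/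
theorem sbMat_lower_apply_of_lt (α γ δ : K) (c : ℕ) {a l : Fin (c + 1)} (h : (l : ℕ) < a) : sbMat K α 0 γ δ c (c + 1) a l = 0 := by
  rw [sbMat_apply]
  exact sbSeq_lower_apply_eq_zero K α γ δ c (P := (l : ℕ)) (fun j hj => if_neg (by omega)) h

/-- … with diagonal `S_c(α 0 γ δ)_{l,l} = α^{c−l} δ^l` (H2 `sbSeq_lower_apply_self`). -/
theorem sbMat_lower_apply_self (α γ δ : K) (c : ℕ) (l : Fin (c + 1)) : sbMat K α 0 γ δ c (c + 1) l l = α ^ (c - (l : ℕ)) * δ ^ (l : ℕ) := by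
  rw [sbMat_apply, sbSeq_lower_apply_self K α γ δ c _ (show (l : ℕ) ≤ c by have := l.2; omega) (fun j hj => if_neg (by omega)), if_pos rfl, mul_one]

/-- `S_c(α 0 γ δ)` is upper triangular (Mathlib's `BlockTriangular id`). -/
theorem sbMat_lower_blockTriangular (α γ δ : K) (c : ℕ) : (sbMat K α 0 γ δ c (c + 1)).BlockTriangular id :=
  fun _ _ h => sbMat_lower_apply_of_lt K α γ δ c h

/-- `Σ_{l ≤ c} l = c(c+1)/2` over `Fin (c+1)`. -/
private lemma sum_fin_val_eq (c : ℕ) : ∑ l : Fin (c + 1), (l : ℕ) = c * (c + 1) / 2 := by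
  rw [Fin.sum_univ_eq_sum_range (fun l => l) (c + 1), Finset.sum_range_id, Nat.add_sub_cancel, Nat.mul_comm]

/-- `Σ_{l ≤ c} (c − l) = c(c+1)/2` over `Fin (c+1)`. -/
private lemma sum_fin_sub_val_eq (c : ℕ) : ∑ l : Fin (c + 1), (c - (l : ℕ)) = c * (c + 1) / 2 := by
  rw [Fin.sum_univ_eq_sum_range (fun l => c - l) (c + 1), ← sum_fin_val_eq, Fin.sum_univ_eq_sum_range (fun l => l) (c + 1),
    ← Finset.sum_range_reflect (fun l => l) (c + 1)]
  exact Finset.sum_congr rfl fun l _ => by simp only [Nat.add_sub_cancel]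

/-- **`det S_c(α 0 γ δ) = (αδ)^{c(c+1)/2}`** — the product of the diagonal `α^{c−l} δ^l`, `l = 0, …, c`. -/
theorem det_sbMat_lower (α γ δ : K) (c : ℕ) : (sbMat K α 0 γ δ c (c + 1)).det = (α * δ) ^ (c * (c + 1) / 2) := by
  rw [Matrix.det_of_upperTriangular (sbMat_lower_blockTriangular K α γ δ c)]
  simp_rw [sbMat_lower_apply_self]
  rw [Finset.prod_mul_distrib, Finset.prod_pow_eq_pow_sum, Finset.prod_pow_eq_pow_sum, sum_fin_val_eq, sum_fin_sub_val_eq, mul_pow]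

/-! ## §161. The shear: the Pascal matrix -/

/-- **THE MOMENT MATRIX OF THE SHEAR `x ↦ x + λy` IS THE PASCAL MATRIX: `S_c(1 λ 0 1)_{a,l} = C(a,l) λ^{a−l}`** (`0` above the diagonal) — E5's `expMul_eq_sum` on the spike `δ_l`. -/
theorem sbMat_shear_apply (lam : K) (c : ℕ) (a l : Fin (c + 1)) :
    sbMat K 1 lam 0 1 c (c + 1) a l = if (l : ℕ) ≤ a then (((a : ℕ).choose (l : ℕ) : K) * lam ^ ((a : ℕ) - (l : ℕ))) else 0 := by
  rw [sbMat_apply, sbSeq_shear K lam c _ (show (a : ℕ) ≤ c by have := a.2; omega), expMul_eq_sum]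
  by_cases h : (l : ℕ) ≤ a
  · rw [if_pos h, Finset.sum_eq_single (l : ℕ)]
    · rw [if_pos rfl, mul_one]
    · intro i _ hi; rw [if_neg hi, mul_zero]
    · intro hl; exact absurd (Finset.mem_range.mpr (by omega)) hl
  · rw [if_neg h]
    refine Finset.sum_eq_zero fun i hi => ?_
    have hil : i ≠ (l : ℕ) := by have := Finset.mem_range.mp hi; omega
    rw [if_neg hil, mul_zero]

/-- the Pascal matrix is lower triangular … -/
theorem sbMat_shear_blockTriangular (lam : K) (c : ℕ) : (sbMat K 1 lam 0 1 c (c + 1)).BlockTriangular OrderDual.toDual := by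
  intro a l h
  have h' : (a : ℕ) < l := h
  rw [sbMat_shear_apply, if_neg (by omega)]

/-- **… and unipotent: `det S_c(1 λ 0 1) = 1`.** -/
theorem det_sbMat_shear (lam : K) (c : ℕ) : (sbMat K 1 lam 0 1 c (c + 1)).det = 1 := by
  rw [Matrix.det_of_lowerTriangular _ (sbMat_shear_blockTriangular K lam c)]
  refine Finset.prod_eq_one fun a _ => ?_
  rw [sbMat_shear_apply, if_pos le_rfl, Nat.choose_self, Nat.cast_one, Nat.sub_self, pow_zero, mul_one]

/-! ## §162. The determinant of the moment matrix -/

/-- `α ≠ 0`: `det S_c(g) = (det g)^{c(c+1)/2}` by the `LU` factorization `g = (α, 0, γ, (αδ−βγ)/α)·(1, β/α, 0, 1)`. -/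
theorem det_sbMat_of_ne {α : K} (hα : α ≠ 0) (β γ δ : K) (c : ℕ) : (sbMat K α β γ δ c (c + 1)).det = (α * δ - β * γ) ^ (c * (c + 1) / 2) := by
  have e := sbMat_comp K α 0 γ ((α * δ - β * γ) / α) 1 (β / α) 0 1 c
  have e1 : α * 1 + 0 * 0 = α := by ring
  have e2 : α * (β / α) + 0 * 1 = β := by rw [zero_mul, add_zero, mul_div_cancel₀ β hα]
  have e3 : γ * 1 + (α * δ - β * γ) / α * 0 = γ := by ring
  have e4 : γ * (β / α) + (α * δ - β * γ) / α * 1 = δ := by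
    field_simp
    ring
  rw [e1, e2, e3, e4] at e
  rw [e, Matrix.det_mul, det_sbMat_shear, one_mul, det_sbMat_lower, mul_div_cancel₀ _ hα]

/-- **THE DETERMINANT OF THE MOMENT MATRIX: `det S_c(α β γ δ) = (αδ − βγ)^{c(c+1)/2}` for EVERY `α β γ δ`** (singular substitutions included; every field). -/
theorem det_sbMat (α β γ δ : K) (c : ℕ) : (sbMat K α β γ δ c (c + 1)).det = (α * δ - β * γ) ^ (c * (c + 1) / 2) := by
  by_cases hα : α = 0
  · subst hα
    by_cases hβ : β = 0
    · subst hβ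
      rw [det_sbMat_lower, zero_mul, zero_mul, sub_zero]
    · -- `g = (β, β, γ+δ, δ)·(1, 0, −1, 1)`
      have e := sbMat_comp K β β (γ + δ) δ 1 0 (-1) 1 c
      have e1 : β * 1 + β * (-1) = 0 := by ring
      have e2 : β * 0 + β * 1 = β := by ring
      have e3 : (γ + δ) * 1 + δ * (-1) = γ := by ring
      have e4 : (γ + δ) * 0 + δ * 1 = δ := by ring
      rw [e1, e2, e3, e4] at e
      rw [e, Matrix.det_mul, det_sbMat_lower, det_sbMat_of_ne K hβ, one_mul, one_pow, one_mul]
      congr 1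
      ring
  · exact det_sbMat_of_ne K hα β γ δ c

/-- `S_0(g) = 1` for every `g` (degree `0`: the constant moment is untouched). -/
theorem sbMat_zero_degree (α β γ δ : K) : sbMat K α β γ δ 0 1 = 1 := by
  ext a l
  have ha : a = 0 := Fin.eq_zero a
  have hl : l = 0 := Fin.eq_zero l
  subst ha hl
  rw [sbMat_apply, Matrix.one_apply_eq]
  exact sbSeq_zero_zero K α β γ δ _

/-- for `c ≥ 1` the exponent `c(c+1)/2` is positive. -/
private lemma triangle_pos {c : ℕ} (hc : 1 ≤ c) : 0 < c * (c + 1) / 2 := by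
  have h : 2 ≤ c * (c + 1) := by nlinarith
  omega

/-- **`c ≥ 1`: `det S_c(g) = 0 ↔ det g = 0`.** -/
theorem det_sbMat_eq_zero_iff {c : ℕ} (hc : 1 ≤ c) (α β γ δ : K) : (sbMat K α β γ δ c (c + 1)).det = 0 ↔ α * δ - β * γ = 0 := by
  rw [det_sbMat]
  exact pow_eq_zero_iff (triangle_pos hc).ne'

/-- **`c ≥ 1`: `S_c(g)` IS INVERTIBLE IFF `g` IS** (`αδ − βγ ≠ 0`). -/
theorem isUnit_sbMat_iff {c : ℕ} (hc : 1 ≤ c) (α β γ δ : K) : IsUnit (sbMat K α β γ δ c (c + 1)) ↔ α * δ - β * γ ≠ 0 := by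
  rw [Matrix.isUnit_iff_isUnit_det, isUnit_iff_ne_zero, Ne, det_sbMat_eq_zero_iff K hc]

/-- for `det g ≠ 0` the moment matrix is invertible in every degree, with inverse `(det g)^{−c} · S_c(adj g)`. -/
theorem sbMat_inv_eq {α β γ δ : K} (h : α * δ - β * γ ≠ 0) (c : ℕ) :
    (sbMat K α β γ δ c (c + 1))⁻¹ = ((α * δ - β * γ) ^ c)⁻¹ • sbMat K δ (-β) (-γ) α c (c + 1) := by
  have hu : IsUnit (sbMat K α β γ δ c (c + 1)).det := by
    rw [det_sbMat, isUnit_iff_ne_zero]; exact pow_ne_zero _ h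
  refine Matrix.inv_eq_left_inv ?_
  rw [Matrix.smul_mul, sbMat_adj_mul, smul_smul, inv_mul_cancel₀ (pow_ne_zero c h), one_smul]

end Summit.Ventures.HSemireg.Wedge.HankelFrameChange
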